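import Literature.Analysis.FluidPDE.TaoH1FourierMildSolution
import Literature.Analysis.FluidPDE.NSFourierTaoClass
import HarnessLib

/-!
# Sobolev bounds and `L²`-continuity of the solution synthesized from a Fourier-side
# `H¹`-mild solution of Sobolev class; proof of `sobolevMild_classical`

Third and last file of the discharge of `Literature.Analysis.FluidPDE.sobolevMild_classical`
(`TaoH1FourierMild.lean`; T. Tao, Anal. PDE 6 (2013) = arXiv:1108.1165, Thm. 5.4 (iv) with (i):
"`∂ₜʲ u, ∂ₜʲ p ∈ L^∞_t H^k([0, T] × ℝ³)` for all `j, k ≥ 0`" and "`u ∈ C⁰_t H¹_x`" for the `H¹` mild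
solution with `H^∞` datum). For `v` with `IsSobolevMild (4π²ν) T a v`, `a` of Sobolev class, and
the fields `u(t) = synthVel (v t)`, `p(t) = Re 𝓕 presSymbol (v t) (v t)` of
`TaoH1FourierMildSolution`:

* the **word-derivative dictionary with moment hypotheses** for a synthesis `synthVel V₀`
  (`ipderiv_synthVel_eq_of_moments`: `∂^α (synthVel V₀)ᵢ = Re 𝓕 (dsym α · V₀ᵢ)`; the tree's
  `ipderiv_synthVel_eq` asks continuity and pointwise decay of `V₀`) and the resulting
  **Plancherel identity** `∫ |∇ᵐ synthVel V₀|² = (2π)^{2m} ∫ ‖ξ‖^{2m} ∑ₗ ‖V₀ₗ‖²`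
  (`lintegral_levelSq_synthVel_eq_of_moments`) and, on `ℝ³`, the bound
  `∫ ‖Dⁿ synthVel V₀‖² ≤ 3^{n+1} (2π)^{2n} ∑ₗ ‖Gₗ‖²_{L²}` by square-integrable envelopes
  `‖ξ‖ⁿ ‖V₀ₗ‖ ≤ Gₗ` (`lintegral_sq_norm_iteratedFDeriv_synthVel_le_of_env`);
* `IsSobolevMild.hasBoundedSobolevNormsOn_u` — `u ∈ L^∞_t H^k_x` for all `k` (envelopes of
  `TaoH1FourierMildFamily`); `IsSobolevMild.hasBoundedSobolevNormsOn_timeDerivWithin` —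
  `∂ₜu ∈ L^∞_t H^k_x` (the one-sided time derivative is the synthesis of
  `-c‖ξ‖² v − N(v, v)`, whose envelopes are those of `v` two orders up plus the pointwise decay of
  the nonlinearity); `IsSobolevMild.sobolev_p` — `p ∈ L^∞_t H^k_x` (the tree's bound for measurable
  symbols with every decay, `lintegral_sq_norm_iteratedFDeriv_re_fourier_le`);
* `IsSobolevMild.continuousInLpOn_u` — `u ∈ C([0, T]; L²)` (Plancherel and the `L²`-continuity
  of the components of `v`);
* `sobolevMild_classical_holds : sobolevMild_classical`.

## Mathlib / tree search

Reused: `dsym`, `norm_dsym_le`, `dsym_succ`, `dsym_neg`, `sum_norm_dsym_sq`, `inner_stdVec_right`,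
`synthVel`, `fourier_dsym_mul_real`, `enorm_sq_le_sum_enorm_sq` (`NSFourierSobolev`),
`lintegral_sq_norm_iteratedFDeriv_re_fourier_le` (`NSFourierTaoClass`), `lintegral_sq_fourier_eq`,
`enorm_reVec_sq_le`, `eLpNorm_two_eq_sqrt` (`NSLocalRegular`), `levelSq`,
`sq_norm_iteratedFDeriv_le_pow_mul_levelSq` (`NSEnstrophyPersistence`), `pderiv`, `ipderiv`,
`contDiff_ipderiv` (`CoordDerivatives`). Mathlib: `Real.contDiff_fourier`,
`Real.differentiable_fourier`.

## References

* T. Tao, arXiv:1108.1165 = Anal. PDE 6 (2013), Thm. 5.4 = arXiv Thm. 31 (p. 18), (i), (iv) and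
  the note closing the proof of (iv). [Tao2011]
* J. Leray, Acta Math. 63 (1934), §19, (1.17)–(1.19). [Leray1934]
-/

noncomputable section

open MeasureTheory Real Set Filter Function Complex FourierTransform VectorFourier
  InnerProductSpace
open scoped FourierTransform RealInnerProductSpace ENNReal NNReal ContDiff ComplexConjugate
open _root_.Topology

namespace Literature.Analysis.FluidPDE

namespace FourierNS

variable {ι : Type*} [Fintype ι] [DecidableEq ι]

/-! ### Word derivatives of a synthesis under moment hypotheses -/

section Moments

variable (V₀ : EuclideanSpace ℝ ι → ι → ℂ)

/-- **One letter of the dictionary**: `∂ₗ Re 𝓕 g = Re 𝓕 (−2πi ξₗ g)` for `g ∈ L¹` with integrable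
first moment. [folklore] -/
theorem pderiv_re_fourier_of_integrable {g : EuclideanSpace ℝ ι → ℂ} (hg : Integrable g)
    (hg1 : Integrable fun ξ : EuclideanSpace ℝ ι => ‖ξ‖ * ‖g ξ‖) (l : ι) :
    pderiv l (fun x => (𝓕 g x).re) =
      fun x => (𝓕 (fun ξ => (-(2 * π * I) * ((ξ l : ℝ) : ℂ)) * g ξ) x).re := by
  funext x
  rw [pderiv_apply]
  have hd : DifferentiableAt ℝ (𝓕 g) x := (Real.differentiable_fourier hg hg1) x
  have h1 : fderiv ℝ (fun y => (𝓕 g y).re) x = Complex.reCLM.comp (fderiv ℝ (𝓕 g) x) :=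
    (Complex.reCLM.hasFDerivAt.comp x hd.hasFDerivAt).fderiv
  rw [h1, ContinuousLinearMap.comp_apply, Complex.reCLM_apply,
    fderiv_fourier_apply_of_integrable hg hg1]
  congr 2
  refine congrFun (fourier_congr' fun ξ => ?_) x
  rw [inner_stdVec_right]

omit [DecidableEq ι] in
/-- Moments of a symbol-weighted function: `‖ξ‖ᵏ ‖dsym α ξ · g ξ‖ ≤ (2π)^m ‖ξ‖^{k+m} ‖g ξ‖`, hence
integrable when all moments of `g` are. [folklore] -/
theorem integrable_pow_mul_norm_dsym_mul {g : EuclideanSpace ℝ ι → ℂ}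
    (hmom : ∀ k : ℕ, Integrable fun ξ : EuclideanSpace ℝ ι => ‖ξ‖ ^ k * ‖g ξ‖)
    (hgm : AEStronglyMeasurable g volume) {m : ℕ} (α : Fin m → ι) (k : ℕ) :
    Integrable fun ξ : EuclideanSpace ℝ ι => ‖ξ‖ ^ k * ‖dsym α ξ * g ξ‖ := by
  refine ((hmom (k + m)).const_mul ((2 * π) ^ m)).mono'
    ((continuous_norm.pow k).aestronglyMeasurable.mul
      (((continuous_dsym α).aestronglyMeasurable.mul hgm).norm))
    (Eventually.of_forall fun ξ => ?_)
  rw [Real.norm_of_nonneg (by positivity), norm_mul]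
  calc ‖ξ‖ ^ k * (‖dsym α ξ‖ * ‖g ξ‖) ≤ ‖ξ‖ ^ k * ((2 * π * ‖ξ‖) ^ m * ‖g ξ‖) := by
        gcongr; exact norm_dsym_le α ξ
    _ = (2 * π) ^ m * (‖ξ‖ ^ (k + m) * ‖g ξ‖) := by rw [mul_pow, pow_add]; ring

omit [DecidableEq ι] in
/-- The symbol-weighted components are a.e.-strongly measurable. [folklore] -/
theorem aesm_dsym_mul' (hmeas : ∀ i, AEStronglyMeasurable (fun ξ => V₀ ξ i) volume) {m : ℕ}
    (α : Fin m → ι) (i : ι) : AEStronglyMeasurable (fun ξ => dsym α ξ * V₀ ξ i) volume :=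
  (continuous_dsym α).aestronglyMeasurable.mul (hmeas i)

/-- **Word derivatives on the Fourier side under moment hypotheses**:
`∂^α (synthVel V₀)ᵢ = Re 𝓕 (dsym α · V₀ᵢ)` for every word `α`, for measurable `V₀` all of whose
moments `‖ξ‖ᵏ ‖V₀ᵢ‖` are integrable (induction on the word, one letter at a time). [folklore] -/
theorem ipderiv_synthVel_eq_of_moments (hmeas : ∀ i, AEStronglyMeasurable (fun ξ => V₀ ξ i) volume)
    (hmom : ∀ (k : ℕ) (i : ι), Integrable fun ξ : EuclideanSpace ℝ ι => ‖ξ‖ ^ k * ‖V₀ ξ i‖)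
    (i : ι) : ∀ {m : ℕ} (α : Fin m → ι),
      ipderiv α (fun y => synthVel V₀ y i) = fun x => (𝓕 (fun ξ => dsym α ξ * V₀ ξ i) x).re
  | 0, α => by
      funext x
      simp
  | m + 1, α => by
      rw [ipderiv_succ, ipderiv_synthVel_eq_of_moments hmeas hmom i (Fin.tail α)]
      have hgm := aesm_dsym_mul' V₀ hmeas (Fin.tail α) i
      have hg : Integrable (fun ξ => dsym (Fin.tail α) ξ * V₀ ξ i) := by
        have := integrable_pow_mul_norm_dsym_mul (fun k => hmom k i) (hmeas i) (Fin.tail α) 0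
        simp only [pow_zero, one_mul] at this
        exact (integrable_norm_iff hgm).1 this
      have hg1 : Integrable fun ξ : EuclideanSpace ℝ ι => ‖ξ‖ * ‖dsym (Fin.tail α) ξ * V₀ ξ i‖ := by
        have := integrable_pow_mul_norm_dsym_mul (fun k => hmom k i) (hmeas i) (Fin.tail α) 1
        simpa only [pow_one] using this
      rw [pderiv_re_fourier_of_integrable hg hg1 (α 0)]
      funext x
      congr 2
      refine congrFun (fourier_congr' fun ξ => ?_) x
      rw [dsym_succ]
      ring

omit [DecidableEq ι] in
/-- Components of the synthesis are smooth under moment hypotheses (Mathlib `Real.contDiff_fourier`). [folklore] -/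
theorem contDiff_synthVel_apply_of_moments
    (hmom : ∀ (k : ℕ) (i : ι), Integrable fun ξ : EuclideanSpace ℝ ι => ‖ξ‖ ^ k * ‖V₀ ξ i‖)
    (i : ι) : ContDiff ℝ ∞ fun y => synthVel V₀ y i := by
  have h : (fun y => synthVel V₀ y i) = fun y => (𝓕 (fun ξ => V₀ ξ i) y).re := by
    funext y; rw [synthVel_apply]
  rw [h]
  refine contDiff_infty.2 fun n => ?_
  exact Complex.reCLM.contDiff.comp (Real.contDiff_fourier fun m _ => hmom m i)

omit [DecidableEq ι] in
/-- The synthesis is smooth under moment hypotheses. [folklore] -/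
theorem contDiff_synthVel_of_moments
    (hmom : ∀ (k : ℕ) (i : ι), Integrable fun ξ : EuclideanSpace ℝ ι => ‖ξ‖ ^ k * ‖V₀ ξ i‖) :
    ContDiff ℝ ∞ (synthVel V₀) :=
  contDiff_euclidean.2 fun i => contDiff_synthVel_apply_of_moments V₀ hmom i

/-- **Plancherel identity for one word derivative** (conjugation-symmetric `V₀`, moments, and
square integrability of the weighted component): `∫ (∂^α (synthVel V₀)ᵢ)² dx = ∫ ‖dsym α ξ · V₀ᵢ(ξ)‖² dξ`. [folklore] -/
theorem lintegral_ipderiv_synthVel_sq_eq_of_moments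
    (hmeas : ∀ i, AEStronglyMeasurable (fun ξ => V₀ ξ i) volume)
    (hmom : ∀ (k : ℕ) (i : ι), Integrable fun ξ : EuclideanSpace ℝ ι => ‖ξ‖ ^ k * ‖V₀ ξ i‖)
    (hconj : ∀ ξ l, V₀ (-ξ) l = conj (V₀ ξ l)) {m : ℕ} (α : Fin m → ι) (i : ι)
    (h2 : MemLp (fun ξ => dsym α ξ * V₀ ξ i) 2 volume) :
    ∫⁻ x, ENNReal.ofReal (ipderiv α (fun y => synthVel V₀ y i) x ^ 2) =
      ∫⁻ ξ, ‖dsym α ξ * V₀ ξ i‖ₑ ^ 2 := by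
  rw [ipderiv_synthVel_eq_of_moments V₀ hmeas hmom i α]
  have hgm := aesm_dsym_mul' V₀ hmeas α i
  have hint : Integrable (fun ξ => dsym α ξ * V₀ ξ i) := by
    have := integrable_pow_mul_norm_dsym_mul (fun k => hmom k i) (hmeas i) α 0
    simp only [pow_zero, one_mul] at this
    exact (integrable_norm_iff hgm).1 this
  rw [← lintegral_sq_fourier_eq hint h2]
  refine lintegral_congr fun x => ?_
  rw [← ofReal_norm, ← ENNReal.ofReal_pow (norm_nonneg _)]
  congr 1
  conv_rhs => rw [fourier_dsym_mul_real V₀ hconj α i x, Complex.norm_real, Real.norm_eq_abs,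
    sq_abs]

/-- Unfolding `levelSq` under `∫⁻ ofReal`: a double finite sum of the word integrals. [folklore] -/
theorem lintegral_levelSq_synthVel_eq_sum_of_moments
    (hmom : ∀ (k : ℕ) (i : ι), Integrable fun ξ : EuclideanSpace ℝ ι => ‖ξ‖ ^ k * ‖V₀ ξ i‖) (m : ℕ) :
    ∫⁻ x, ENNReal.ofReal (levelSq m (synthVel V₀) x) =
      ∑ i, ∑ α : Fin m → ι, ∫⁻ x, ENNReal.ofReal (ipderiv α (fun y => synthVel V₀ y i) x ^ 2) := by
  have hmeas : ∀ (i : ι) (α : Fin m → ι),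
      Measurable fun x => ENNReal.ofReal (ipderiv α (fun y => synthVel V₀ y i) x ^ 2) :=
    fun i α => ((contDiff_ipderiv (contDiff_synthVel_apply_of_moments V₀ hmom i) α).continuous.pow
      2).measurable.ennreal_ofReal
  calc ∫⁻ x, ENNReal.ofReal (levelSq m (synthVel V₀) x)
      = ∫⁻ x, ∑ i, ∑ α : Fin m → ι,
          ENNReal.ofReal (ipderiv α (fun y => synthVel V₀ y i) x ^ 2) := by
        refine lintegral_congr fun x => ?_
        unfold levelSq dnormSq
        rw [ENNReal.ofReal_sum_of_nonneg fun i _ => Finset.sum_nonneg fun α _ => sq_nonneg _]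
        exact Finset.sum_congr rfl fun i _ => ENNReal.ofReal_sum_of_nonneg fun α _ => sq_nonneg _
    _ = ∑ i, ∫⁻ x, ∑ α : Fin m → ι,
          ENNReal.ofReal (ipderiv α (fun y => synthVel V₀ y i) x ^ 2) :=
        lintegral_finsetSum _ fun i _ => Finset.measurable_fun_sum _ fun α _ => hmeas i α
    _ = _ := Finset.sum_congr rfl fun i _ => lintegral_finsetSum _ fun α _ => hmeas i α

omit [DecidableEq ι] in
/-- Square integrability of the symbol-weighted components from a square-integrable envelope of
order `m`: `‖ξ‖^m ‖V₀ᵢ‖ ≤ Gᵢ ∈ L²` gives `dsym α · V₀ᵢ ∈ L²` for words of length `m`. [folklore] -/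
theorem memLp_dsym_mul_of_env (hmeas : ∀ i, AEStronglyMeasurable (fun ξ => V₀ ξ i) volume)
    {m : ℕ} (α : Fin m → ι) (i : ι) {G : EuclideanSpace ℝ ι → ℝ} (hG : MemLp G 2 volume)
    (hle : ∀ ξ, ‖ξ‖ ^ m * ‖V₀ ξ i‖ ≤ G ξ) :
    MemLp (fun ξ => dsym α ξ * V₀ ξ i) 2 volume := by
  refine MemLp.of_le (hG.norm.const_mul ((2 * π) ^ m)) (aesm_dsym_mul' V₀ hmeas α i)
    (Eventually.of_forall fun ξ => ?_)
  have hG0 : 0 ≤ G ξ := le_trans (by positivity) (hle ξ)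
  rw [norm_mul, norm_mul, norm_norm, Real.norm_of_nonneg (by positivity : (0 : ℝ) ≤ (2 * π) ^ m),
    Real.norm_of_nonneg hG0]
  calc ‖dsym α ξ‖ * ‖V₀ ξ i‖ ≤ (2 * π * ‖ξ‖) ^ m * ‖V₀ ξ i‖ :=
        mul_le_mul_of_nonneg_right (norm_dsym_le α ξ) (norm_nonneg _)
    _ = (2 * π) ^ m * (‖ξ‖ ^ m * ‖V₀ ξ i‖) := by rw [mul_pow]; ring
    _ ≤ (2 * π) ^ m * G ξ := mul_le_mul_of_nonneg_left (hle ξ) (by positivity)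

/-- **Plancherel identity for the coordinate tensors** under moment hypotheses and envelopes of
order `m`: `∫ |∇ᵐ synthVel V₀|² dx = (2π)^{2m} ∫ ‖ξ‖^{2m} ∑ₗ ‖V₀ₗ(ξ)‖² dξ`. [folklore] -/
theorem lintegral_levelSq_synthVel_eq_of_moments
    (hmeas : ∀ i, AEStronglyMeasurable (fun ξ => V₀ ξ i) volume)
    (hmom : ∀ (k : ℕ) (i : ι), Integrable fun ξ : EuclideanSpace ℝ ι => ‖ξ‖ ^ k * ‖V₀ ξ i‖)
    (hconj : ∀ ξ l, V₀ (-ξ) l = conj (V₀ ξ l)) (m : ℕ) {G : ι → EuclideanSpace ℝ ι → ℝ}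
    (hG : ∀ i, MemLp (G i) 2 volume) (hle : ∀ ξ i, ‖ξ‖ ^ m * ‖V₀ ξ i‖ ≤ G i ξ) :
    ∫⁻ x, ENNReal.ofReal (levelSq m (synthVel V₀) x) =
      ENNReal.ofReal ((2 * π) ^ (2 * m)) *
        ∫⁻ ξ, ENNReal.ofReal (‖ξ‖ ^ (2 * m)) * ∑ l, ‖V₀ ξ l‖ₑ ^ 2 := by
  rw [lintegral_levelSq_synthVel_eq_sum_of_moments V₀ hmom m]
  have hstep : ∀ (i : ι) (α : Fin m → ι),
      ∫⁻ x, ENNReal.ofReal (ipderiv α (fun y => synthVel V₀ y i) x ^ 2) =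
        ∫⁻ ξ, ‖dsym α ξ * V₀ ξ i‖ₑ ^ 2 := fun i α =>
    lintegral_ipderiv_synthVel_sq_eq_of_moments V₀ hmeas hmom hconj α i
      (memLp_dsym_mul_of_env V₀ hmeas α i (hG i) (fun ξ => hle ξ i))
  simp_rw [hstep]
  have hmeas' : ∀ (i : ι) (α : Fin m → ι),
      AEMeasurable (fun ξ => ‖dsym α ξ * V₀ ξ i‖ₑ ^ 2) volume := fun i α =>
    (aesm_dsym_mul' V₀ hmeas α i).aemeasurable.enorm.pow_const 2
  rw [Finset.sum_comm]
  calc ∑ α : Fin m → ι, ∑ i, ∫⁻ ξ, ‖dsym α ξ * V₀ ξ i‖ₑ ^ 2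
      = ∫⁻ ξ, ∑ α : Fin m → ι, ∑ i, ‖dsym α ξ * V₀ ξ i‖ₑ ^ 2 := by
        rw [lintegral_finsetSum' _ fun α _ => Finset.aemeasurable_fun_sum _ fun i _ => hmeas' i α]
        exact Finset.sum_congr rfl fun α _ => (lintegral_finsetSum' _ fun i _ => hmeas' i α).symm
    _ = ∫⁻ ξ, ENNReal.ofReal ((2 * π) ^ (2 * m)) *
          (ENNReal.ofReal (‖ξ‖ ^ (2 * m)) * ∑ l, ‖V₀ ξ l‖ₑ ^ 2) := by
        refine lintegral_congr fun ξ => ?_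
        have h1 : ∀ (α : Fin m → ι) (i : ι), ‖dsym α ξ * V₀ ξ i‖ₑ ^ 2 =
            ENNReal.ofReal (‖dsym α ξ‖ ^ 2) * ‖V₀ ξ i‖ₑ ^ 2 := fun α i => by
          rw [enorm_mul, mul_pow, ← ofReal_norm (dsym α ξ), ENNReal.ofReal_pow (norm_nonneg _)]
        simp_rw [h1, ← Finset.mul_sum, ← Finset.sum_mul]
        rw [← ENNReal.ofReal_sum_of_nonneg fun α _ => sq_nonneg _, sum_norm_dsym_sq,
          ENNReal.ofReal_mul (by positivity), mul_assoc]
    _ = _ := lintegral_const_mul' _ _ ENNReal.ofReal_ne_top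

omit [DecidableEq ι] in
/-- `ofReal (‖ξ‖^{2m}) ‖z‖ₑ² = ‖ ‖ξ‖^m ‖z‖ ‖ₑ²`. [folklore] -/
theorem ofReal_pow_mul_enorm_sq (ξ : EuclideanSpace ℝ ι) (m : ℕ) (z : ℂ) :
    ENNReal.ofReal (‖ξ‖ ^ (2 * m)) * ‖z‖ₑ ^ 2 = ‖‖ξ‖ ^ m * ‖z‖‖ₑ ^ 2 := by
  rw [Real.enorm_eq_ofReal (by positivity), ← ofReal_norm z,
    ← ENNReal.ofReal_pow (norm_nonneg _), ← ENNReal.ofReal_mul (by positivity),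
    ← ENNReal.ofReal_pow (by positivity)]
  congr 1
  rw [mul_pow, ← pow_mul, mul_comm m 2]

/-- **All Sobolev norms of a synthesis on `ℝ³` from square-integrable envelopes**:
`∫ ‖Dⁿ synthVel V₀‖² ≤ 3^{n+1} (2π)^{2n} ∑ₗ ∫ Gₗ²` whenever `‖ξ‖ⁿ ‖V₀ₗ(ξ)‖ ≤ Gₗ(ξ)` with `Gₗ ∈ L²`
(and `V₀` measurable, conjugation symmetric, with integrable moments). [folklore] -/
theorem lintegral_sq_norm_iteratedFDeriv_synthVel_le_of_env
    (V₀ : EuclideanSpace ℝ (Fin 3) → Fin 3 → ℂ)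
    (hmeas : ∀ i, AEStronglyMeasurable (fun ξ => V₀ ξ i) volume)
    (hmom : ∀ (k : ℕ) (i : Fin 3), Integrable fun ξ : EuclideanSpace ℝ (Fin 3) => ‖ξ‖ ^ k * ‖V₀ ξ i‖)
    (hconj : ∀ ξ l, V₀ (-ξ) l = conj (V₀ ξ l)) (n : ℕ) {G : Fin 3 → EuclideanSpace ℝ (Fin 3) → ℝ}
    (hG : ∀ i, MemLp (G i) 2 volume) (hle : ∀ ξ i, ‖ξ‖ ^ n * ‖V₀ ξ i‖ ≤ G i ξ) :
    ∫⁻ x, ‖iteratedFDeriv ℝ n (synthVel V₀) x‖ₑ ^ 2 ≤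
      ENNReal.ofReal (3 ^ (n + 1) * (2 * π) ^ (2 * n)) * ∑ l, ∫⁻ ξ, ‖G l ξ‖ₑ ^ 2 := by
  have hv := contDiff_synthVel_of_moments V₀ hmom
  have hGm : ∀ l, AEMeasurable (fun ξ => ‖G l ξ‖ₑ ^ 2) volume := fun l =>
    (hG l).aestronglyMeasurable.aemeasurable.enorm.pow_const 2
  calc ∫⁻ x, ‖iteratedFDeriv ℝ n (synthVel V₀) x‖ₑ ^ 2
      ≤ ∫⁻ x, ENNReal.ofReal (3 ^ (n + 1) * levelSq n (synthVel V₀) x) := by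
        refine lintegral_mono fun x => ?_
        rw [← ofReal_norm, ← ENNReal.ofReal_pow (norm_nonneg _)]
        exact ENNReal.ofReal_le_ofReal (sq_norm_iteratedFDeriv_le_pow_mul_levelSq hv n x)
    _ = ENNReal.ofReal (3 ^ (n + 1)) * ∫⁻ x, ENNReal.ofReal (levelSq n (synthVel V₀) x) := by
        rw [← lintegral_const_mul' _ _ ENNReal.ofReal_ne_top]
        refine lintegral_congr fun x => ?_
        rw [ENNReal.ofReal_mul (by positivity)]
    _ = ENNReal.ofReal (3 ^ (n + 1)) * (ENNReal.ofReal ((2 * π) ^ (2 * n)) *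
          ∫⁻ ξ, ENNReal.ofReal (‖ξ‖ ^ (2 * n)) * ∑ l, ‖V₀ ξ l‖ₑ ^ 2) := by
        rw [lintegral_levelSq_synthVel_eq_of_moments V₀ hmeas hmom hconj n hG hle]
    _ ≤ ENNReal.ofReal (3 ^ (n + 1)) * (ENNReal.ofReal ((2 * π) ^ (2 * n)) *
          ∫⁻ ξ, ∑ l, ‖G l ξ‖ₑ ^ 2) := by
        gcongr with ξ
        rw [Finset.mul_sum]
        refine Finset.sum_le_sum fun l _ => ?_
        rw [ofReal_pow_mul_enorm_sq]
        have h0 : 0 ≤ ‖ξ‖ ^ n * ‖V₀ ξ l‖ := by positivity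
        have h1 : ‖‖ξ‖ ^ n * ‖V₀ ξ l‖‖ₑ ≤ ‖G l ξ‖ₑ := by
          rw [Real.enorm_eq_ofReal h0, Real.enorm_eq_ofReal (h0.trans (hle ξ l))]
          exact ENNReal.ofReal_le_ofReal (hle ξ l)
        exact pow_le_pow_left' h1 2
    _ = ENNReal.ofReal (3 ^ (n + 1) * (2 * π) ^ (2 * n)) * ∑ l, ∫⁻ ξ, ‖G l ξ‖ₑ ^ 2 := by
        rw [lintegral_finsetSum' _ fun l _ => hGm l, ← mul_assoc,
          ← ENNReal.ofReal_mul (by positivity)]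

end Moments

/-! ### The solution: `u`, `∂ₜu`, `p` in `L^∞_t H^k_x`, and `u ∈ C([0, T]; L²)` -/

section Solution

variable {c T : ℝ} {a : EuclideanSpace ℝ (Fin 3) → Fin 3 → ℂ}
  {v : ℝ → EuclideanSpace ℝ (Fin 3) → Fin 3 → ℂ}

open ClayDatum (reVec reVec_apply)

/-- `∫ ‖G‖ₑ² < ∞` for `G ∈ L²`. [folklore] -/
theorem lintegral_enorm_sq_lt_top_of_memLp {G : EuclideanSpace ℝ (Fin 3) → ℝ} (hG : MemLp G 2 volume) :
    ∫⁻ ξ, ‖G ξ‖ₑ ^ 2 < ⊤ := by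
  rw [lintegral_enorm_sq_eq_eLpNorm_sq]
  exact ENNReal.pow_lt_top hG.eLpNorm_lt_top

/-- **`u ∈ L^∞_t H^k_x` for every `k`** (Tao 2011, Thm. 5.4 (iv), `j = 0`): the Sobolev norms of
`u(t) = synthVel (v t)` are bounded uniformly in time (indeed on all of `ℝ`), by the Plancherel
bound with the time-uniform square-integrable envelopes of `v`. [cite: Tao2011, Thm. 5.4 (iv)] -/
theorem IsSobolevMild.hasBoundedSobolevNormsOn_u (h : IsSobolevMild c T a v) (hc : 0 ≤ c)
    (ha : IsSobolevFourierDatum a) (S : Set ℝ) :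
    HasBoundedSobolevNormsOn S (fun t => synthVel (v t)) := by
  intro n
  have hdom : ∀ l : Fin 3, ∃ G : EuclideanSpace ℝ (Fin 3) → ℝ, MemLp G 2 volume ∧
      ∀ t ξ, (1 + ‖ξ‖) ^ n * ‖v t ξ l‖ ≤ G ξ := fun l => h.exists_dom hc ha n l
  choose G hG hle using hdom
  set C : ℝ≥0∞ := ENNReal.ofReal (3 ^ (n + 1) * (2 * π) ^ (2 * n)) * ∑ l, ∫⁻ ξ, ‖G l ξ‖ₑ ^ 2
    with hCdef
  have hC : C < ⊤ := ENNReal.mul_lt_top ENNReal.ofReal_lt_top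
    (ENNReal.sum_lt_top.2 fun l _ => lintegral_enorm_sq_lt_top_of_memLp (hG l))
  refine ⟨C.toNNReal, fun t _ => ?_⟩
  rw [ENNReal.coe_toNNReal hC.ne]
  refine lintegral_sq_norm_iteratedFDeriv_synthVel_le_of_env (v t) (fun i => h.aesm_apply t i)
    (fun k i => h.integrable_pow_mul_norm hc ha k t i) (fun ξ l => h.conjSymm t ξ l) n hG
    fun ξ i => ?_
  calc ‖ξ‖ ^ n * ‖v t ξ i‖ ≤ (1 + ‖ξ‖) ^ n * ‖v t ξ i‖ := by
        gcongr; linarith [norm_nonneg ξ]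
    _ ≤ G i ξ := hle i t ξ

/-! #### The time derivative -/

/-- The one-sided time derivative of `u` within `[0, T]` is the synthesis of the symbol
`-c‖ξ‖² vₗ(t) − N(v(t), v(t))ₗ` (the expression is spelled out; no definition). [folklore] -/
theorem IsSobolevMild.timeDerivWithin_u_eq_synthVel (h : IsSobolevMild c T a v) (hc : 0 ≤ c)
    (hT : 0 < T) (ha : IsSobolevFourierDatum a) {t : ℝ} (ht : t ∈ Icc 0 T) :
    timeDerivWithin (Icc 0 T) (fun s => synthVel (v s)) t = synthVel fun ξ l =>
      -((c * ‖ξ‖ ^ 2 : ℝ) : ℂ) * v t ξ l - nonlin (v t) (v t) ξ l := by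
  funext x
  rw [h.timeDerivWithin_u hc hT ha x ht]
  rfl

/-- The time-derivative symbol is conjugation symmetric (reality of `∂ₜu`). [folklore] -/
theorem IsSobolevMild.dtSymbol_conj (h : IsSobolevMild c T a v) (t : ℝ)
    (ξ : EuclideanSpace ℝ (Fin 3)) (l : Fin 3) :
    (-((c * ‖-ξ‖ ^ 2 : ℝ) : ℂ) * v t (-ξ) l - nonlin (v t) (v t) (-ξ) l) =
      conj (-((c * ‖ξ‖ ^ 2 : ℝ) : ℂ) * v t ξ l - nonlin (v t) (v t) ξ l) := by
  rw [norm_neg, h.conjSymm t ξ l, nonlin_conj_symm (h.conjSymm t) (h.conjSymm t) ξ l, map_sub,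
    map_mul, map_neg, Complex.conj_ofReal]

/-- Moments of the time-derivative symbol on `[0, T]` are integrable
(`‖ξ‖ᵏ c‖ξ‖² ‖v‖` two orders up, `‖ξ‖ᵏ ‖N‖` by the pointwise decay of the nonlinearity). [folklore] -/
theorem IsSobolevMild.integrable_pow_mul_norm_dtSymbol (h : IsSobolevMild c T a v) (hc : 0 ≤ c)
    (hT : 0 < T) (ha : IsSobolevFourierDatum a) {t : ℝ} (ht : t ∈ Icc 0 T) (k : ℕ) (l : Fin 3) :
    Integrable fun ξ : EuclideanSpace ℝ (Fin 3) =>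
      ‖ξ‖ ^ k * ‖-((c * ‖ξ‖ ^ 2 : ℝ) : ℂ) * v t ξ l - nonlin (v t) (v t) ξ l‖ := by
  obtain ⟨B, hB⟩ := h.hasDecay_nonlin hc hT ha (k + (Fintype.card (Fin 3) + 1)) l
  have hN := (hB t ht).1.integrable_pow_mul_norm (n := k)
    (finrank_lt_of_card_lt (Nat.lt_succ_self _)) (hB t ht).2
  have hv := (h.integrable_pow_mul_norm hc ha (k + 2) t l).const_mul c
  have hmeas : AEStronglyMeasurable (fun ξ : EuclideanSpace ℝ (Fin 3) =>
      -((c * ‖ξ‖ ^ 2 : ℝ) : ℂ) * v t ξ l - nonlin (v t) (v t) ξ l) volume :=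
    ((Continuous.aestronglyMeasurable (by fun_prop)).mul (h.aesm_apply t l)).sub (hB t ht).2
  refine (hv.add hN).mono' ((continuous_norm.pow k).aestronglyMeasurable.mul hmeas.norm)
    (Eventually.of_forall fun ξ => ?_)
  rw [Real.norm_of_nonneg (by positivity)]
  calc ‖ξ‖ ^ k * ‖-((c * ‖ξ‖ ^ 2 : ℝ) : ℂ) * v t ξ l - nonlin (v t) (v t) ξ l‖
      ≤ ‖ξ‖ ^ k * (‖-((c * ‖ξ‖ ^ 2 : ℝ) : ℂ) * v t ξ l‖ + ‖nonlin (v t) (v t) ξ l‖) :=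
        mul_le_mul_of_nonneg_left (norm_sub_le _ _) (by positivity)
    _ = c * (‖ξ‖ ^ (k + 2) * ‖v t ξ l‖) + ‖ξ‖ ^ k * ‖nonlin (v t) (v t) ξ l‖ := by
        rw [norm_mul, norm_neg, Complex.norm_real, Real.norm_of_nonneg (by positivity), pow_add]
        ring

/-- **Square-integrable envelopes of the time-derivative symbol**, uniformly on `[0, T]`:
`‖ξ‖ⁿ ‖-c‖ξ‖² vₗ − Nₗ‖ ≤ c G_{n+2} + B (1+‖ξ‖)^{-K₀}`. [folklore] -/
theorem IsSobolevMild.exists_env_dtSymbol (h : IsSobolevMild c T a v) (hc : 0 ≤ c) (hT : 0 < T)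
    (ha : IsSobolevFourierDatum a) (n : ℕ) (l : Fin 3) :
    ∃ G : EuclideanSpace ℝ (Fin 3) → ℝ, MemLp G 2 volume ∧ ∀ t ∈ Icc 0 T, ∀ ξ,
      ‖ξ‖ ^ n * ‖-((c * ‖ξ‖ ^ 2 : ℝ) : ℂ) * v t ξ l - nonlin (v t) (v t) ξ l‖ ≤ G ξ := by
  set K₀ := Fintype.card (Fin 3) + 1 with hK₀
  obtain ⟨G₂, hG₂, hle₂⟩ := h.exists_dom hc ha (n + 2) l
  obtain ⟨B, hB⟩ := h.hasDecay_nonlin hc hT ha (n + K₀) l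
  refine ⟨fun ξ => c * G₂ ξ + B * ((1 + ‖ξ‖) ^ K₀)⁻¹, ?_, fun t ht ξ => ?_⟩
  · exact (hG₂.const_mul c).add ((memLp_inv_one_add_norm_pow_two (ι := Fin 3)).const_mul B)
  · have hN : ‖ξ‖ ^ n * ‖nonlin (v t) (v t) ξ l‖ ≤ B * ((1 + ‖ξ‖) ^ K₀)⁻¹ :=
      ((hB t ht).1).pow_mul_norm_le (n := n) (K := K₀) ξ
    have hv : ‖ξ‖ ^ (n + 2) * ‖v t ξ l‖ ≤ G₂ ξ := by
      calc ‖ξ‖ ^ (n + 2) * ‖v t ξ l‖ ≤ (1 + ‖ξ‖) ^ (n + 2) * ‖v t ξ l‖ := by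
            gcongr; linarith [norm_nonneg ξ]
        _ ≤ G₂ ξ := hle₂ t ξ
    calc ‖ξ‖ ^ n * ‖-((c * ‖ξ‖ ^ 2 : ℝ) : ℂ) * v t ξ l - nonlin (v t) (v t) ξ l‖
        ≤ ‖ξ‖ ^ n * (‖-((c * ‖ξ‖ ^ 2 : ℝ) : ℂ) * v t ξ l‖ + ‖nonlin (v t) (v t) ξ l‖) :=
          mul_le_mul_of_nonneg_left (norm_sub_le _ _) (by positivity)
      _ = c * (‖ξ‖ ^ (n + 2) * ‖v t ξ l‖) + ‖ξ‖ ^ n * ‖nonlin (v t) (v t) ξ l‖ := by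
          rw [norm_mul, norm_neg, Complex.norm_real, Real.norm_of_nonneg (by positivity), pow_add]
          ring
      _ ≤ c * G₂ ξ + B * ((1 + ‖ξ‖) ^ K₀)⁻¹ := add_le_add (mul_le_mul_of_nonneg_left hv hc) hN

/-- **`∂ₜu ∈ L^∞_t H^k_x([0, T] × ℝ³)` for every `k`** (Tao 2011, Thm. 5.4 (iv), `j = 1`): the
Sobolev norms of the one-sided time derivative are bounded on `[0, T]` (Plancherel bound for the
synthesis of the time-derivative symbol with its time-uniform envelopes). [cite: Tao2011, Thm. 5.4 (iv)] -/
theorem IsSobolevMild.hasBoundedSobolevNormsOn_timeDerivWithin (h : IsSobolevMild c T a v)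
    (hc : 0 ≤ c) (hT : 0 < T) (ha : IsSobolevFourierDatum a) :
    HasBoundedSobolevNormsOn (Icc 0 T) (timeDerivWithin (Icc 0 T) (fun s => synthVel (v s))) := by
  intro n
  have hdom := fun l : Fin 3 => h.exists_env_dtSymbol hc hT ha n l
  choose G hG hle using hdom
  set C : ℝ≥0∞ := ENNReal.ofReal (3 ^ (n + 1) * (2 * π) ^ (2 * n)) * ∑ l, ∫⁻ ξ, ‖G l ξ‖ₑ ^ 2
    with hCdef
  have hC : C < ⊤ := ENNReal.mul_lt_top ENNReal.ofReal_lt_top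
    (ENNReal.sum_lt_top.2 fun l _ => lintegral_enorm_sq_lt_top_of_memLp (hG l))
  refine ⟨C.toNNReal, fun t ht => ?_⟩
  rw [ENNReal.coe_toNNReal hC.ne, h.timeDerivWithin_u_eq_synthVel hc hT ha ht]
  set V₁ : EuclideanSpace ℝ (Fin 3) → Fin 3 → ℂ := fun ξ l =>
    -((c * ‖ξ‖ ^ 2 : ℝ) : ℂ) * v t ξ l - nonlin (v t) (v t) ξ l with hV₁
  have hmeas : ∀ i, AEStronglyMeasurable (fun ξ => V₁ ξ i) volume := fun i => by
    obtain ⟨B, hB⟩ := h.hasDecay_nonlin hc hT ha 0 i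
    exact ((Continuous.aestronglyMeasurable (by fun_prop)).mul (h.aesm_apply t i)).sub (hB t ht).2
  exact lintegral_sq_norm_iteratedFDeriv_synthVel_le_of_env V₁ hmeas
    (fun k i => h.integrable_pow_mul_norm_dtSymbol hc hT ha ht k i)
    (fun ξ l => h.dtSymbol_conj t ξ l) n hG (fun ξ i => hle i t ht ξ)

/-! #### The pressure -/

/-- **`p ∈ L^∞_t H^k_x([0, T] × ℝ³)` for every `k`** (Tao 2011, Thm. 5.4 (iv), `j = 0` for the
pressure): `p = Re 𝓕 q` with `q(t) = presSymbol (v t) (v t)` measurable with every polynomial decay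
uniformly on `[0, T]`. [cite: Tao2011, Thm. 5.4 (iv)] -/
theorem IsSobolevMild.sobolev_p (h : IsSobolevMild c T a v) (hc : 0 ≤ c) (hT : 0 < T)
    (ha : IsSobolevFourierDatum a) : ∀ n : ℕ, ∃ C : ℝ≥0, ∀ t ∈ Icc 0 T,
      ∫⁻ x, ‖iteratedFDeriv ℝ n (fun y => (𝓕 (presSymbol (v t) (v t)) y).re) x‖ₑ ^ 2 ≤ C := by
  intro n
  obtain ⟨B, hB⟩ := h.hasDecay_presSymbol hc hT ha (Fintype.card (Fin 3) + 1 + n)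
  set C : ℝ≥0∞ := ENNReal.ofReal ((Fintype.card (Fin 3) : ℝ) ^ n) *
    (Fintype.card (Fin n → Fin 3) * ENNReal.ofReal (((2 * π) ^ n * B) ^ 2 *
      weightMass (EuclideanSpace ℝ (Fin 3)) (Fintype.card (Fin 3) + 1))) with hCdef
  have hC : C < ⊤ := ENNReal.mul_lt_top ENNReal.ofReal_lt_top
    (ENNReal.mul_lt_top (ENNReal.natCast_lt_top _) ENNReal.ofReal_lt_top)
  refine ⟨C.toNNReal, fun t ht => ?_⟩
  rw [ENNReal.coe_toNNReal hC.ne]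
  have hdec : ∀ K : ℕ, ∃ B', HasDecay K B' (presSymbol (v t) (v t)) := fun K => by
    obtain ⟨B', hB'⟩ := h.hasDecay_presSymbol hc hT ha K
    exact ⟨B', (hB' t ht).1⟩
  exact lintegral_sq_norm_iteratedFDeriv_re_fourier_le (hB t ht).2 hdec n (hB t ht).1

/-! #### Continuity in `L²` -/

/-- The complex velocity components are in `L²` with `∫ ‖𝓕 vₗ(t)‖² = ∫ ‖vₗ(t)‖²`. [folklore] -/
theorem IsSobolevMild.lintegral_sq_fourier_apply_eq (h : IsSobolevMild c T a v) (hc : 0 ≤ c)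
    (ha : IsSobolevFourierDatum a) (t : ℝ) (l : Fin 3) :
    ∫⁻ x, ‖𝓕 (fun ξ => v t ξ l) x‖ₑ ^ 2 = ∫⁻ ξ, ‖v t ξ l‖ₑ ^ 2 :=
  lintegral_sq_fourier_eq (h.integrable_apply hc ha t l) (h.memLp_apply hc ha t l)

/-- Pointwise: `‖u t x − u t₀ x‖² ≤ ∑ₗ ‖𝓕 (vₗ t − vₗ t₀) x‖²`. [folklore] -/
theorem IsSobolevMild.enorm_u_sub_sq_le (h : IsSobolevMild c T a v) (hc : 0 ≤ c)
    (ha : IsSobolevFourierDatum a) (t t₀ : ℝ) (x : EuclideanSpace ℝ (Fin 3)) :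
    ‖synthVel (v t) x - synthVel (v t₀) x‖ₑ ^ 2 ≤
      ∑ l, ‖𝓕 (fun ξ => v t ξ l - v t₀ ξ l) x‖ₑ ^ 2 := by
  have hsub : synthVel (v t) x - synthVel (v t₀) x =
      reVec (fun l => 𝓕 (fun ξ => v t ξ l - v t₀ ξ l) x) := by
    have h1 : synthVel (v t) x - synthVel (v t₀) x =
        reVec ((fun l => 𝓕 (fun ξ => v t ξ l) x) - fun l => 𝓕 (fun ξ => v t₀ ξ l) x) := by
      rw [map_sub]; rfl
    rw [h1]
    congr 1
    funext l
    rw [Pi.sub_apply, ← fourier_sub' (h.integrable_apply hc ha t l) (h.integrable_apply hc ha t₀ l)]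
    rfl
  rw [hsub]
  exact enorm_reVec_sq_le _

/-- **`∫ ‖u(t) − u(t₀)‖² → 0` as `t → t₀`** (Plancherel componentwise and the `L²`-continuity of
the components of `v`). [folklore] -/
theorem IsSobolevMild.tendsto_lintegral_u_sub (h : IsSobolevMild c T a v) (hc : 0 ≤ c)
    (ha : IsSobolevFourierDatum a) (t₀ : ℝ) :
    Tendsto (fun t => ∫⁻ x, ‖synthVel (v t) x - synthVel (v t₀) x‖ₑ ^ 2) (𝓝 t₀) (𝓝 0) := by
  have hvj : ∀ t j, Integrable fun ξ => v t ξ j := fun t j => h.integrable_apply hc ha t j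
  have hsum : Tendsto (fun t => ∑ l, ∫⁻ x, ‖𝓕 (fun ξ => v t ξ l - v t₀ ξ l) x‖ₑ ^ 2) (𝓝 t₀)
      (𝓝 0) := by
    rw [show (0 : ℝ≥0∞) = ∑ _l : Fin 3, 0 by simp]
    refine tendsto_finsetSum _ fun l _ => ?_
    have heq : ∀ t, ∫⁻ x, ‖𝓕 (fun ξ => v t ξ l - v t₀ ξ l) x‖ₑ ^ 2 =
        eLpNorm ((v t · l) - (v t₀ · l)) 2 volume ^ 2 := fun t => by
      have e := lintegral_sq_fourier_eq ((hvj t l).sub (hvj t₀ l))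
        ((h.memLp_apply hc ha t l).sub (h.memLp_apply hc ha t₀ l))
      rw [← lintegral_enorm_sq_eq_eLpNorm_sq]
      exact e
    simp_rw [heq]
    have h2 := ENNReal.Tendsto.pow (n := 2) (h.tendsto_eLpNorm_sub hc ha l t₀)
    simpa using h2
  refine tendsto_of_tendsto_of_tendsto_of_le_of_le tendsto_const_nhds hsum (fun _ => bot_le) fun t => ?_
  calc ∫⁻ x, ‖synthVel (v t) x - synthVel (v t₀) x‖ₑ ^ 2
      ≤ ∫⁻ x, ∑ l, ‖𝓕 (fun ξ => v t ξ l - v t₀ ξ l) x‖ₑ ^ 2 :=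
        lintegral_mono (h.enorm_u_sub_sq_le hc ha t t₀)
    _ = ∑ l, ∫⁻ x, ‖𝓕 (fun ξ => v t ξ l - v t₀ ξ l) x‖ₑ ^ 2 := by
        refine lintegral_finsetSum' _ fun l _ => ?_
        exact (continuous_fourierIntegral ((hvj t l).sub (hvj t₀ l))).measurable.enorm.pow_const 2
          |>.aemeasurable

/-- **`u(t) ∈ L²`** for every `t` (`∫ ‖u(t)‖² ≤ ∑ₗ ∫ ‖vₗ(t)‖² < ∞`). [folklore] -/
theorem IsSobolevMild.memLp_u (h : IsSobolevMild c T a v) (hc : 0 ≤ c)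
    (ha : IsSobolevFourierDatum a) (t : ℝ) : MemLp (synthVel (v t)) 2 volume := by
  have hcont : Continuous (synthVel (v t)) :=
    (contDiff_synthVel_of_moments (v t) fun k i => h.integrable_pow_mul_norm hc ha k t i).continuous
  refine ⟨hcont.aestronglyMeasurable, ?_⟩
  rw [eLpNorm_two_eq_sqrt]
  refine ENNReal.rpow_lt_top_of_nonneg (by norm_num) (ne_of_lt ?_)
  have hvj : ∀ j, Integrable fun ξ => v t ξ j := fun j => h.integrable_apply hc ha t j
  calc ∫⁻ x, ‖synthVel (v t) x‖ₑ ^ 2 ≤ ∫⁻ x, ∑ l, ‖𝓕 (fun ξ => v t ξ l) x‖ₑ ^ 2 :=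
        lintegral_mono fun x => enorm_reVec_sq_le _
    _ = ∑ l, ∫⁻ x, ‖𝓕 (fun ξ => v t ξ l) x‖ₑ ^ 2 := by
        refine lintegral_finsetSum' _ fun l _ => ?_
        exact (continuous_fourierIntegral (hvj l)).measurable.enorm.pow_const 2 |>.aemeasurable
    _ = ∑ l, ∫⁻ ξ, ‖v t ξ l‖ₑ ^ 2 := Finset.sum_congr rfl fun l _ =>
        h.lintegral_sq_fourier_apply_eq hc ha t l
    _ < ⊤ := by
        refine ENNReal.sum_lt_top.2 fun l _ => ?_
        rw [lintegral_enorm_sq_eq_eLpNorm_sq]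
        exact ENNReal.pow_lt_top (h.memLp_apply hc ha t l).eLpNorm_lt_top

/-- **`u ∈ C([0, T]; L²)`** (indeed on all of `ℝ`; Tao 2011, Thm. 5.4 (i): `u ∈ C⁰_t H¹_x`, here
the `L²` part). [cite: Tao2011, Thm. 5.4 (i)] -/
theorem IsSobolevMild.continuousInLpOn_u (h : IsSobolevMild c T a v) (hc : 0 ≤ c)
    (ha : IsSobolevFourierDatum a) : ContinuousInLpOn (Icc 0 T) 2 (fun t => synthVel (v t)) := by
  refine ⟨fun t _ => h.memLp_u hc ha t, fun t₀ _ => ?_⟩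
  have h1 : Tendsto (fun t => eLpNorm (synthVel (v t) - synthVel (v t₀)) 2 volume) (𝓝 t₀) (𝓝 0) := by
    have h2 : ∀ t, eLpNorm (synthVel (v t) - synthVel (v t₀)) 2 volume =
        (∫⁻ x, ‖synthVel (v t) x - synthVel (v t₀) x‖ₑ ^ 2) ^ (1 / 2 : ℝ) := fun t =>
      eLpNorm_two_eq_sqrt _
    simp_rw [h2]
    have h3 := (ENNReal.continuous_rpow_const (y := (1 / 2 : ℝ))).tendsto 0
    rw [ENNReal.zero_rpow_of_pos (by norm_num)] at h3
    exact h3.comp (h.tendsto_lintegral_u_sub hc ha t₀)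
  exact h1.mono_left nhdsWithin_le_nhds

end Solution

end FourierNS

/-! ### Proof of `sobolevMild_classical` -/

open FourierNS in
/-- **Tao 2011, Thm. 5.4 (iv) with (i), Fourier side — discharged.** For `ν > 0`, `T > 0`, a
datum `a` of Sobolev class and a Fourier-side mild solution `v` (`IsSobolevMild (4π²ν) T a v`), the
synthesis `u(t) = synthVel (v t)` with the pressure `Re 𝓕 presSymbol (v t) (v t)` is a classical
solution of the unforced Navier–Stokes system on the closed slab `[0, T] × ℝ³`, with
`u, ∂ₜu, p ∈ L^∞_t H^k_x` for every `k` and `u ∈ C([0, T]; L²)`. [cite: Tao2011, Thm. 5.4 (iv)] -/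
theorem sobolevMild_classical_holds : sobolevMild_classical := by
  intro ν T hν hT a ha v hv
  have hc : 0 ≤ 4 * π ^ 2 * ν := by positivity
  exact ⟨fun t x => (𝓕 (presSymbol (v t) (v t)) x).re, hv.isClassicalNSSolutionOn hν.le hT ha,
    hv.hasBoundedSobolevNormsOn_u hc ha (Icc 0 T), hv.hasBoundedSobolevNormsOn_timeDerivWithin hc hT ha,
    hv.sobolev_p hc hT ha, hv.continuousInLpOn_u hc ha⟩

end Literature.Analysis.FluidPDE

end
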